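import Mathlib

/-!
# `MatrixDescartes` census — the EXTERIOR-TANGENT LAW: at the deepest point of a return excursion the tangent pencil is non-definite

HONEST FRAMING.  Object-search cell `pub-symmetroid`, door-A seat `val-sym-door-p1` (g13); helper beside the OPEN typed statements
`DoorA26 = PosRootLawAt 2 6 19` (stmt-ValiantsHypothesis-19979) and `DoorA34` (19980), asserted nowhere.  An ALL-SUPPORTS, ROOT-SIDE
necessary condition of a new (non-log-linear, derivative) kind, valid for every real symmetric `2 × 2` pencil of any length `K` and any
support `d`, indeed for any `C¹` path of real symmetric `2 × 2` matrices.

THE LAW.  Let `F : ℝ → Sym₂(ℝ)` be differentiable, and let `(α, β)` be a GAP of `det F`: `det F(α) = det F(β) = 0`, `det F < 0` on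
`(α, β)` (the pencil is indefinite inside), with `tr F(α) > 0` and `tr F(β) > 0` (both boundary matrices are positive semidefinite of rank
one: a «RETURN EXCURSION» between two positive-definite gaps; the negative case is the same statement for `−F`).  Then there is a point
`x₀ ∈ (α, β)` — the DEEPEST point, where `ρ = tr F / √(tr² F − 4 det F)` (the cosine of the polar angle from the identity axis of the
Minkowski model `Sym₂(ℝ) ≅ ℝ^{1,2}`) attains its minimum over `[α, β]` — at which

* `tr F · (det F)' = 2 · det F · (tr F)'`                                   (`exteriorTangent_gap`, critical relation),
* `det(F' − μ F) · tr² F ≤ det F · tr²(F' − μ F)` for EVERY real `μ`         (the whole affine line `F(x₀) + t F'(x₀)` is at least as deep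
                                                                              in the indefinite belt as `F(x₀)` itself),
* hence `det(F'(x₀) − μ F(x₀)) ≤ 0` for every `μ`                            (NO matrix on the tangent line is definite: the tangent line of
                                                                              the projective curve `[F]` at `x₀` does not enter the conic
                                                                              `det = 0` — it is an EXTERIOR or tangent line), and
* `((det F)'(x₀))² ≤ 4 · det F(x₀) · det F'(x₀)`, in particular `det F'(x₀) ≤ 0`   (discriminant form).

For a pencil `F(x) = Σ_l x^{d_l} S_l` on a gap inside `(0, ∞)` the same holds with the EULER PENCIL `E(x) = x F'(x) = Σ_l d_l x^{d_l} S_l`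
(same support, letters `d_l S_l`) in place of `F'` (companion module `…CensusExteriorTangentPencil`, `exteriorTangent_pencil`): at the deepest point of every return excursion,
`det(E(x₀) − μ F(x₀)) ≤ 0` for all `μ`, and `(x₀ f'(x₀))² ≤ 4 f(x₀) · det E(x₀)` where `f = det F`.

WHY IT MATTERS (door A).  A hypothetical `(2,6)` twenty has `20` simple positive det-roots and `21` gaps alternating definite /
indefinite; by the envelope budget (`…CensusEnvelopeBudget`: the type flips ≤ 3 times) all but at most three of its bounded indefinite
gaps are return excursions, and on each of them the law produces a point where the `21`-nomials `f = det F`, `g = det E`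
(coefficients `d_i d_j c_{ij}`) and `x f'` (coefficients `(d_i + d_j) c_{ij}`) satisfy the QUADRATIC root-side row `(x f')² ≤ 4 f g`.
In the two-term regime near a breakpoint between a positive monomial `c_U x^{s_U}` and the negative window monomial `c_V x^{s_V}`
(`A = c_U x^{s_U} > 0 > B = c_V x^{s_V}`, `A + B < 0`; `s` the pair sum, `δ` the letter spread of the pair) the row reads
`4fg − (xf')² = −δ_U² A² − δ_V² B² + ((s_V − s_U)² − δ_U² − δ_V²)·AB ≥ 0`, possible only if `|s_V − s_U| ≤ |δ_U − δ_V|` and (with `A < |B|`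
and the `μ`-family at the letters) only if the letter interval of the NEGATIVE pair lies inside that of the POSITIVE pair — an oriented
nesting / ratio condition, indicative only (the census eighteens sit in 3–4-term regimes at their deepest points); seat report
DOOR-A-P1-REPORT §63–§65 (located, not typed here; this paragraph CORRECTS the first landed wording, which had a sign error).  Nothing in this file bounds `ζ_sym(2,6)` or `ζ_sym(3,4)`,
decides `DoorA26`/`DoorA34`, or bears on `MatrixDescartes` (stmt-ValiantsHypothesis-18050) / `VP ≠ VNP`.

PROOF.  `ρ` is continuous on `[α, β]` (the radicand `tr² F − 4 det F` is `> 0` there), equals `1` at both ends and is `< 1` inside, so its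
minimum is interior and `ρ' = 0` there, which unwinds to the critical relation.  The inequality is then pure algebra in the coordinates
`r = tr F/2`, `p = (F₀₀ − F₁₁)/2`, `q = F₀₁` (`det F = r² − p² − q²`): the critical relation says `r ⟨P, P'⟩ = |P|² r'` for `P = (p, q)`, hence
`|P|² (r' − μ r) = r ⟨P, P' − μ P⟩`, and Cauchy–Schwarz `⟨P, Q⟩² ≤ |P|² |Q|²` gives `|P|² (r' − μ r)² ≤ r² |P' − μ P|²`, which is the claim.

[folklore] Extreme value theorem, Fermat's stationary-point theorem, Cauchy–Schwarz in `ℝ²`; elementary.  (The geometric reading —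
«at the point of a spherical curve farthest from the pole the tangent great circle stays in the belt» — is classical spherical geometry.)
-/

-- `Summit.ValiantsHypothesis.ValiantsHypothesis.…` repeats a component by the D-0017 layout
-- (single-conjunct summit), which the `dupNamespace` linter flags; the name is mandated.
set_option linter.dupNamespace false

namespace Summit.ValiantsHypothesis.ValiantsHypothesis.Theorems.LacunarySymmetroidMatrixDescartes.Census

open Set Finset
open scoped BigOperators Topology

/-! ### 1. Algebra at a critical point of the polar angle (Minkowski coordinates `r, p, q`) -/

/-- Core algebra in Minkowski coordinates.  If `u = (r, p, q)` is spacelike (`r² − p² − q² < 0`) and `u' = (r', p', q')` satisfies the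
critical relation `r (p p' + q q') = (p² + q²) r'` (stationarity of `r/√(p²+q²)` along `u + t u'`), then for every `μ` the vector
`u' − μ u` is at least as deep in the spacelike belt as `u`: `⟨u'−μu, u'−μu⟩ · (2r)² ≤ ⟨u, u⟩ · (2(r'−μr))²`. [folklore] -/
theorem exteriorTangent_alg_rpq (r p q r' p' q' μ : ℝ) (hf : r ^ 2 - p ^ 2 - q ^ 2 < 0)
    (hcrit : r * (p * p' + q * q') = (p ^ 2 + q ^ 2) * r') :
    ((r' - μ * r) ^ 2 - (p' - μ * p) ^ 2 - (q' - μ * q) ^ 2) * (2 * r) ^ 2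
      ≤ (r ^ 2 - p ^ 2 - q ^ 2) * (2 * (r' - μ * r)) ^ 2 := by
  have hm2 : 0 < p ^ 2 + q ^ 2 := by nlinarith [sq_nonneg r]
  have key : (p ^ 2 + q ^ 2) * (r' - μ * r) = r * (p * (p' - μ * p) + q * (q' - μ * q)) := by
    linear_combination (-1 : ℝ) * hcrit
  have h1 : (p ^ 2 + q ^ 2) * ((p ^ 2 + q ^ 2) * (r' - μ * r) ^ 2)
      = r ^ 2 * (p * (p' - μ * p) + q * (q' - μ * q)) ^ 2 := by
    calc (p ^ 2 + q ^ 2) * ((p ^ 2 + q ^ 2) * (r' - μ * r) ^ 2)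
        = ((p ^ 2 + q ^ 2) * (r' - μ * r)) ^ 2 := by ring
      _ = (r * (p * (p' - μ * p) + q * (q' - μ * q))) ^ 2 := by rw [key]
      _ = r ^ 2 * (p * (p' - μ * p) + q * (q' - μ * q)) ^ 2 := by ring
  have h2 : (p ^ 2 + q ^ 2) * (r ^ 2 * ((p' - μ * p) ^ 2 + (q' - μ * q) ^ 2) - (p ^ 2 + q ^ 2) * (r' - μ * r) ^ 2)
      = r ^ 2 * (p * (q' - μ * q) - q * (p' - μ * p)) ^ 2 := by
    linear_combination (-1 : ℝ) * h1
  have h3 : 0 ≤ r ^ 2 * ((p' - μ * p) ^ 2 + (q' - μ * q) ^ 2) - (p ^ 2 + q ^ 2) * (r' - μ * r) ^ 2 := by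
    have h4 : 0 ≤ (p ^ 2 + q ^ 2) *
        (r ^ 2 * ((p' - μ * p) ^ 2 + (q' - μ * q) ^ 2) - (p ^ 2 + q ^ 2) * (r' - μ * r) ^ 2) := by
      rw [h2]; positivity
    exact le_of_mul_le_mul_left (by simpa using h4) hm2
  nlinarith [h3]

/-- Same point, second conclusion: no vector on the line `u' − μ u` is timelike, `⟨u'−μu, u'−μu⟩ ≤ 0`. [folklore] -/
theorem exteriorTangent_alg_rpq_nonpos (r p q r' p' q' μ : ℝ) (hf : r ^ 2 - p ^ 2 - q ^ 2 < 0)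
    (hcrit : r * (p * p' + q * q') = (p ^ 2 + q ^ 2) * r') :
    (r' - μ * r) ^ 2 - (p' - μ * p) ^ 2 - (q' - μ * q) ^ 2 ≤ 0 := by
  have hA := exteriorTangent_alg_rpq r p q r' p' q' μ hf hcrit
  by_cases hr : r = 0
  · subst hr
    have hm2 : 0 < p ^ 2 + q ^ 2 := by nlinarith
    have hr' : r' = 0 := by
      have : (p ^ 2 + q ^ 2) * r' = 0 := by simpa using hcrit.symm
      rcases mul_eq_zero.mp this with h | h
      · exact absurd h hm2.ne'
      · exact h
    subst hr'
    nlinarith [sq_nonneg (p' - μ * p), sq_nonneg (q' - μ * q)]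
  · have hr2 : 0 < (2 * r) ^ 2 := by positivity
    have hB : (r ^ 2 - p ^ 2 - q ^ 2) * (2 * (r' - μ * r)) ^ 2 ≤ 0 :=
      mul_nonpos_of_nonpos_of_nonneg hf.le (sq_nonneg _)
    nlinarith [hA, hB, hr2]

/-! ### 2. The same algebra in matrix entries `a = F₀₀`, `b = F₀₁`, `c = F₁₁` -/

/-- **Critical-point algebra, matrix form.**  Let `a, b, c` (entries of a symmetric `2 × 2` matrix `F`) satisfy `a c − b² < 0`, and let
`a', b', c'` (entries of `F'`) satisfy the critical relation `(a + c)·(a' c + a c' − 2 b b') = 2 (a c − b²)(a' + c')`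
(`tr F · (det F)' = 2 det F · (tr F)'`).  Then for every `μ`:
`det(F' − μF) · tr² F ≤ det F · tr²(F' − μF)`. [folklore] -/
theorem exteriorTangent_alg (a b c a' b' c' μ : ℝ) (hf : a * c - b ^ 2 < 0)
    (hcrit : (a + c) * (a' * c + a * c' - 2 * b * b') = 2 * (a * c - b ^ 2) * (a' + c')) :
    ((a' - μ * a) * (c' - μ * c) - (b' - μ * b) ^ 2) * (a + c) ^ 2
      ≤ (a * c - b ^ 2) * ((a' + c') - μ * (a + c)) ^ 2 := by
  have h := exteriorTangent_alg_rpq ((a + c) / 2) ((a - c) / 2) b ((a' + c') / 2) ((a' - c') / 2) b' μ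
    (by nlinarith) (by linear_combination (-1 / 4 : ℝ) * hcrit)
  have e1 : ((a' - μ * a) * (c' - μ * c) - (b' - μ * b) ^ 2) * (a + c) ^ 2
      = (((a' + c') / 2 - μ * ((a + c) / 2)) ^ 2 - ((a' - c') / 2 - μ * ((a - c) / 2)) ^ 2 - (b' - μ * b) ^ 2)
        * (2 * ((a + c) / 2)) ^ 2 := by ring
  have e2 : (a * c - b ^ 2) * ((a' + c') - μ * (a + c)) ^ 2
      = (((a + c) / 2) ^ 2 - ((a - c) / 2) ^ 2 - b ^ 2) * (2 * ((a' + c') / 2 - μ * ((a + c) / 2))) ^ 2 := by ring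
  rw [e1, e2]; exact h

/-- Matrix form, second conclusion: `det(F' − μ F) ≤ 0` for every `μ` — no matrix on the tangent line is definite. [folklore] -/
theorem exteriorTangent_alg_nonpos (a b c a' b' c' μ : ℝ) (hf : a * c - b ^ 2 < 0)
    (hcrit : (a + c) * (a' * c + a * c' - 2 * b * b') = 2 * (a * c - b ^ 2) * (a' + c')) :
    (a' - μ * a) * (c' - μ * c) - (b' - μ * b) ^ 2 ≤ 0 := by
  have h := exteriorTangent_alg_rpq_nonpos ((a + c) / 2) ((a - c) / 2) b ((a' + c') / 2) ((a' - c') / 2) b' μ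
    (by nlinarith) (by linear_combination (-1 / 4 : ℝ) * hcrit)
  nlinarith [h]

/-- Matrix form, discriminant conclusion: `((det F)')² ≤ 4 det F · det F'`; as `det F < 0` this forces `det F' ≤ 0`. [folklore] -/
theorem exteriorTangent_alg_disc (a b c a' b' c' : ℝ) (hf : a * c - b ^ 2 < 0)
    (hcrit : (a + c) * (a' * c + a * c' - 2 * b * b') = 2 * (a * c - b ^ 2) * (a' + c')) :
    (a' * c + a * c' - 2 * b * b') ^ 2 ≤ 4 * (a * c - b ^ 2) * (a' * c' - b' ^ 2) := by
  -- evaluate the non-definiteness at `μ₀ = f'/(2f)`, the vertex of the quadratic `μ ↦ det(F' − μF) = det F' − f' μ + f μ²`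
  have hf0 : a * c - b ^ 2 ≠ 0 := hf.ne
  have h := exteriorTangent_alg_nonpos a b c a' b' c'
    ((a' * c + a * c' - 2 * b * b') / (2 * (a * c - b ^ 2))) hf hcrit
  have hg : ∀ μ : ℝ, (a' - μ * a) * (c' - μ * c) - (b' - μ * b) ^ 2
      = (a' * c' - b' ^ 2) - μ * (a' * c + a * c' - 2 * b * b') + μ ^ 2 * (a * c - b ^ 2) := fun μ => by ring
  have hμ0 : 2 * (a * c - b ^ 2) * ((a' * c + a * c' - 2 * b * b') / (2 * (a * c - b ^ 2)))
      = a' * c + a * c' - 2 * b * b' := by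
    field_simp
  rw [hg] at h
  have e : 4 * (a * c - b ^ 2) * ((a' * c' - b' ^ 2)
        - ((a' * c + a * c' - 2 * b * b') / (2 * (a * c - b ^ 2))) * (a' * c + a * c' - 2 * b * b')
        + ((a' * c + a * c' - 2 * b * b') / (2 * (a * c - b ^ 2))) ^ 2 * (a * c - b ^ 2))
      = 4 * (a * c - b ^ 2) * (a' * c' - b' ^ 2) - (a' * c + a * c' - 2 * b * b') ^ 2 := by
    calc 4 * (a * c - b ^ 2) * ((a' * c' - b' ^ 2)
          - ((a' * c + a * c' - 2 * b * b') / (2 * (a * c - b ^ 2))) * (a' * c + a * c' - 2 * b * b')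
          + ((a' * c + a * c' - 2 * b * b') / (2 * (a * c - b ^ 2))) ^ 2 * (a * c - b ^ 2))
        = 4 * (a * c - b ^ 2) * (a' * c' - b' ^ 2)
          - 2 * (2 * (a * c - b ^ 2) * ((a' * c + a * c' - 2 * b * b') / (2 * (a * c - b ^ 2))))
              * (a' * c + a * c' - 2 * b * b')
          + (2 * (a * c - b ^ 2) * ((a' * c + a * c' - 2 * b * b') / (2 * (a * c - b ^ 2)))) ^ 2 := by ring
      _ = 4 * (a * c - b ^ 2) * (a' * c' - b' ^ 2) - 2 * (a' * c + a * c' - 2 * b * b') * (a' * c + a * c' - 2 * b * b')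
          + (a' * c + a * c' - 2 * b * b') ^ 2 := by rw [hμ0]
      _ = _ := by ring
  have h4 : 0 ≤ 4 * (a * c - b ^ 2) * ((a' * c' - b' ^ 2)
        - ((a' * c + a * c' - 2 * b * b') / (2 * (a * c - b ^ 2))) * (a' * c + a * c' - 2 * b * b')
        + ((a' * c + a * c' - 2 * b * b') / (2 * (a * c - b ^ 2))) ^ 2 * (a * c - b ^ 2)) :=
    mul_nonneg_of_nonpos_of_nonpos (by linarith) h
  rw [e] at h4
  linarith

/-! ### 3. The analytic law on a gap of `det F` -/

/-- **EXTERIOR-TANGENT LAW on a gap (existence of the deepest point and its critical relation).**  Let `a, b, c : ℝ → ℝ` be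
differentiable (entries of a symmetric `2 × 2` matrix path `F`, derivative entries `a', b', c'`), and let `α < β` with
`det F(α) = det F(β) = 0`, `det F < 0` on `(α, β)` and `tr F(α) > 0`, `tr F(β) > 0` (a return excursion between two positive-definite
gaps).  Then the polar cosine `ρ = tr F / √(tr² F − 4 det F)` attains its minimum over `[α, β]` at an INTERIOR point `x₀`, where the
critical relation `tr F · (det F)' = 2 det F · (tr F)'` holds. [folklore] -/
theorem exteriorTangent_gap {a b c a' b' c' : ℝ → ℝ}
    (ha : ∀ x, HasDerivAt a (a' x) x) (hb : ∀ x, HasDerivAt b (b' x) x) (hc : ∀ x, HasDerivAt c (c' x) x)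
    {α β : ℝ} (hαβ : α < β)
    (hfα : a α * c α - b α ^ 2 = 0) (hfβ : a β * c β - b β ^ 2 = 0)
    (hneg : ∀ x ∈ Ioo α β, a x * c x - b x ^ 2 < 0)
    (hTα : 0 < a α + c α) (hTβ : 0 < a β + c β) :
    ∃ x₀ ∈ Ioo α β,
      (∀ x ∈ Icc α β,
        (a x₀ + c x₀) / Real.sqrt ((a x₀ + c x₀) ^ 2 - 4 * (a x₀ * c x₀ - b x₀ ^ 2))
          ≤ (a x + c x) / Real.sqrt ((a x + c x) ^ 2 - 4 * (a x * c x - b x ^ 2))) ∧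
      (a x₀ + c x₀) * (a' x₀ * c x₀ + a x₀ * c' x₀ - 2 * b x₀ * b' x₀)
        = 2 * (a x₀ * c x₀ - b x₀ ^ 2) * (a' x₀ + c' x₀) := by
  -- the three scalar functions: determinant `f`, trace `T`, radicand `R = T² − 4f`, and the polar cosine `ρ = T/√R`
  obtain ⟨f, hf⟩ : ∃ f : ℝ → ℝ, ∀ x, f x = a x * c x - b x ^ 2 := ⟨_, fun _ => rfl⟩
  obtain ⟨T, hT⟩ : ∃ T : ℝ → ℝ, ∀ x, T x = a x + c x := ⟨_, fun _ => rfl⟩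
  obtain ⟨R, hR⟩ : ∃ R : ℝ → ℝ, ∀ x, R x = T x ^ 2 - 4 * f x := ⟨_, fun _ => rfl⟩
  obtain ⟨ρ, hρ⟩ : ∃ ρ : ℝ → ℝ, ∀ x, ρ x = T x / Real.sqrt (R x) := ⟨_, fun _ => rfl⟩
  -- continuity
  have hca : Continuous a := continuous_iff_continuousAt.2 fun x => (ha x).continuousAt
  have hcb : Continuous b := continuous_iff_continuousAt.2 fun x => (hb x).continuousAt
  have hcc : Continuous c := continuous_iff_continuousAt.2 fun x => (hc x).continuousAt
  have hcT : Continuous T := by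
    have : T = fun x => a x + c x := funext hT
    rw [this]; exact hca.add hcc
  have hcf : Continuous f := by
    have : f = fun x => a x * c x - b x ^ 2 := funext hf
    rw [this]; exact (hca.mul hcc).sub (hcb.pow 2)
  have hcR : Continuous R := by
    have : R = fun x => T x ^ 2 - 4 * f x := funext hR
    rw [this]; exact (hcT.pow 2).sub (continuous_const.mul hcf)
  -- the radicand is positive on the closed gap
  have hRpos : ∀ x ∈ Icc α β, 0 < R x := by
    intro x hx
    by_cases hxα : x = α
    · subst hxα; rw [hR, hT, hf, hfα]; nlinarith
    by_cases hxβ : x = β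
    · subst hxβ; rw [hR, hT, hf, hfβ]; nlinarith
    have hx' : x ∈ Ioo α β := ⟨lt_of_le_of_ne hx.1 (Ne.symm hxα), lt_of_le_of_ne hx.2 hxβ⟩
    have := hneg x hx'
    rw [hR, hT, hf]; nlinarith [sq_nonneg (a x + c x)]
  have hsqrt_pos : ∀ x ∈ Icc α β, 0 < Real.sqrt (R x) := fun x hx => Real.sqrt_pos.2 (hRpos x hx)
  have hcρ : ContinuousOn ρ (Icc α β) := by
    have : ρ = fun x => T x / Real.sqrt (R x) := funext hρ
    rw [this]
    exact hcT.continuousOn.div (Real.continuous_sqrt.comp hcR).continuousOn fun x hx => (hsqrt_pos x hx).ne'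
  -- the minimum of `ρ` on the compact gap
  obtain ⟨x₀, hx₀, hmin⟩ := isCompact_Icc.exists_isMinOn (nonempty_Icc.2 hαβ.le) hcρ
  -- `ρ = 1` at the two ends, `ρ < 1` inside; so the minimum is interior
  have hρ_end : ∀ x, a x * c x - b x ^ 2 = 0 → 0 < a x + c x → ρ x = 1 := by
    intro x hfx hTx
    have hRx : R x = (a x + c x) ^ 2 := by rw [hR, hT, hf, hfx]; ring
    rw [hρ, hRx, Real.sqrt_sq hTx.le, hT, div_self hTx.ne']
  have hρ_in : ∀ x ∈ Ioo α β, ρ x < 1 := by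
    intro x hx
    have hxI : x ∈ Icc α β := Ioo_subset_Icc_self hx
    have hs := hsqrt_pos x hxI
    rw [hρ, div_lt_one hs]
    by_cases hTx : T x ≤ 0
    · exact lt_of_le_of_lt hTx hs
    · have hTx' : 0 < T x := lt_of_not_ge hTx
      calc T x = Real.sqrt (T x ^ 2) := (Real.sqrt_sq hTx'.le).symm
        _ < Real.sqrt (R x) := by
            apply Real.sqrt_lt_sqrt (sq_nonneg _)
            have := hneg x hx
            rw [hR, hf]; linarith
  have hmid : (α + β) / 2 ∈ Ioo α β := ⟨by linarith, by linarith⟩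
  have hmin_mid : ρ x₀ ≤ ρ ((α + β) / 2) := hmin (Ioo_subset_Icc_self hmid)
  have hx₀α : α < x₀ := by
    refine lt_of_le_of_ne hx₀.1 fun h => ?_
    have h1 : ρ x₀ = 1 := by rw [← h]; exact hρ_end α hfα hTα
    linarith [hρ_in _ hmid]
  have hx₀β : x₀ < β := by
    refine lt_of_le_of_ne hx₀.2 fun h => ?_
    have h1 : ρ x₀ = 1 := by rw [h]; exact hρ_end β hfβ hTβ
    linarith [hρ_in _ hmid]
  have hx₀' : x₀ ∈ Ioo α β := ⟨hx₀α, hx₀β⟩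
  -- derivatives at `x₀`
  have hdT : HasDerivAt T (a' x₀ + c' x₀) x₀ := by
    have : T = fun x => a x + c x := funext hT
    rw [this]; exact (ha x₀).add (hc x₀)
  have hdf : HasDerivAt f (a' x₀ * c x₀ + a x₀ * c' x₀ - 2 * b x₀ * b' x₀) x₀ := by
    have e : f = fun x => a x * c x - b x * b x := by funext x; rw [hf]; ring
    rw [e]
    exact (((ha x₀).mul (hc x₀)).sub ((hb x₀).mul (hb x₀))).congr_deriv (by ring)
  have hdR : HasDerivAt R (2 * T x₀ * (a' x₀ + c' x₀) - 4 * (a' x₀ * c x₀ + a x₀ * c' x₀ - 2 * b x₀ * b' x₀)) x₀ := by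
    have e : R = fun x => T x * T x - 4 * f x := by funext x; rw [hR]; ring
    rw [e]
    exact ((hdT.mul hdT).sub (hdf.const_mul 4)).congr_deriv (by ring)
  have hR0 : R x₀ ≠ 0 := (hRpos x₀ hx₀).ne'
  have hs0 : Real.sqrt (R x₀) ≠ 0 := (hsqrt_pos x₀ hx₀).ne'
  have hdS : HasDerivAt (fun x => Real.sqrt (R x))
      ((2 * T x₀ * (a' x₀ + c' x₀) - 4 * (a' x₀ * c x₀ + a x₀ * c' x₀ - 2 * b x₀ * b' x₀)) / (2 * Real.sqrt (R x₀))) x₀ :=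
    hdR.sqrt hR0
  have hdρ : HasDerivAt ρ (((a' x₀ + c' x₀) * Real.sqrt (R x₀) - T x₀ *
      ((2 * T x₀ * (a' x₀ + c' x₀) - 4 * (a' x₀ * c x₀ + a x₀ * c' x₀ - 2 * b x₀ * b' x₀)) / (2 * Real.sqrt (R x₀))))
        / Real.sqrt (R x₀) ^ 2) x₀ := by
    have e : ρ = fun x => T x / Real.sqrt (R x) := funext hρ
    rw [e]; exact hdT.div hdS hs0
  -- Fermat: the derivative vanishes at the interior minimum
  have hloc : IsLocalMin ρ x₀ := hmin.isLocalMin (Icc_mem_nhds hx₀α hx₀β)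
  have hzero := hloc.hasDerivAt_eq_zero hdρ
  have hs2 : Real.sqrt (R x₀) ^ 2 = T x₀ ^ 2 - 4 * f x₀ := by rw [Real.sq_sqrt (hRpos x₀ hx₀).le, hR]
  have hnum : (a' x₀ + c' x₀) * Real.sqrt (R x₀) - T x₀ *
      ((2 * T x₀ * (a' x₀ + c' x₀) - 4 * (a' x₀ * c x₀ + a x₀ * c' x₀ - 2 * b x₀ * b' x₀)) / (2 * Real.sqrt (R x₀))) = 0 := by
    rcases div_eq_zero_iff.mp hzero with h | h
    · exact h
    · exact absurd h (pow_ne_zero 2 hs0)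
  have E1 : 2 * (a' x₀ + c' x₀) * Real.sqrt (R x₀) ^ 2
      = T x₀ * (2 * T x₀ * (a' x₀ + c' x₀) - 4 * (a' x₀ * c x₀ + a x₀ * c' x₀ - 2 * b x₀ * b' x₀)) := by
    have h := sub_eq_zero.mp hnum
    have h2 : (a' x₀ + c' x₀) * Real.sqrt (R x₀) * (2 * Real.sqrt (R x₀))
        = T x₀ * (2 * T x₀ * (a' x₀ + c' x₀) - 4 * (a' x₀ * c x₀ + a x₀ * c' x₀ - 2 * b x₀ * b' x₀)) := by
      rw [h]; field_simp
    linear_combination h2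
  refine ⟨x₀, hx₀', ?_, ?_⟩
  · intro x hx
    have h : ρ x₀ ≤ ρ x := hmin hx
    rw [hρ, hρ, hR, hR, hT, hT, hf, hf] at h
    exact h
  · simp only [hT, hf] at E1 hs2
    linear_combination (1 / 4 : ℝ) * E1 - ((a' x₀ + c' x₀) / 2) * hs2

/-- **EXTERIOR-TANGENT LAW on a gap (the rows).**  Under the hypotheses of `exteriorTangent_gap` there is `x₀ ∈ (α, β)` with
(i) `det(F' − μF)·tr² F ≤ det F·tr²(F' − μF)` for all `μ`; (ii) `det(F'(x₀) − μ F(x₀)) ≤ 0` for all `μ` (no definite matrix on the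
tangent line); (iii) `((det F)'(x₀))² ≤ 4 det F(x₀)·det F'(x₀)`; (iv) `det F'(x₀) ≤ 0`. [folklore] -/
theorem exteriorTangent_gap_rows {a b c a' b' c' : ℝ → ℝ}
    (ha : ∀ x, HasDerivAt a (a' x) x) (hb : ∀ x, HasDerivAt b (b' x) x) (hc : ∀ x, HasDerivAt c (c' x) x)
    {α β : ℝ} (hαβ : α < β)
    (hfα : a α * c α - b α ^ 2 = 0) (hfβ : a β * c β - b β ^ 2 = 0)
    (hneg : ∀ x ∈ Ioo α β, a x * c x - b x ^ 2 < 0)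
    (hTα : 0 < a α + c α) (hTβ : 0 < a β + c β) :
    ∃ x₀ ∈ Ioo α β,
      (∀ μ : ℝ, ((a' x₀ - μ * a x₀) * (c' x₀ - μ * c x₀) - (b' x₀ - μ * b x₀) ^ 2) * (a x₀ + c x₀) ^ 2
          ≤ (a x₀ * c x₀ - b x₀ ^ 2) * ((a' x₀ + c' x₀) - μ * (a x₀ + c x₀)) ^ 2) ∧
      (∀ μ : ℝ, (a' x₀ - μ * a x₀) * (c' x₀ - μ * c x₀) - (b' x₀ - μ * b x₀) ^ 2 ≤ 0) ∧
      (a' x₀ * c x₀ + a x₀ * c' x₀ - 2 * b x₀ * b' x₀) ^ 2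
          ≤ 4 * (a x₀ * c x₀ - b x₀ ^ 2) * (a' x₀ * c' x₀ - b' x₀ ^ 2) ∧
      a' x₀ * c' x₀ - b' x₀ ^ 2 ≤ 0 := by
  obtain ⟨x₀, hx₀, -, hcrit⟩ := exteriorTangent_gap ha hb hc hαβ hfα hfβ hneg hTα hTβ
  have hf := hneg x₀ hx₀
  refine ⟨x₀, hx₀, fun μ => exteriorTangent_alg _ _ _ _ _ _ μ hf hcrit,
    fun μ => exteriorTangent_alg_nonpos _ _ _ _ _ _ μ hf hcrit, exteriorTangent_alg_disc _ _ _ _ _ _ hf hcrit, ?_⟩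
  have h := exteriorTangent_alg_nonpos _ _ _ _ _ _ 0 hf hcrit
  simpa using h

/-- The mirror case (a return excursion between two NEGATIVE-definite gaps: `tr F(α) < 0`, `tr F(β) < 0`), by `F ↦ −F`. [folklore] -/
theorem exteriorTangent_gap_rows_neg {a b c a' b' c' : ℝ → ℝ}
    (ha : ∀ x, HasDerivAt a (a' x) x) (hb : ∀ x, HasDerivAt b (b' x) x) (hc : ∀ x, HasDerivAt c (c' x) x)
    {α β : ℝ} (hαβ : α < β)
    (hfα : a α * c α - b α ^ 2 = 0) (hfβ : a β * c β - b β ^ 2 = 0)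
    (hneg : ∀ x ∈ Ioo α β, a x * c x - b x ^ 2 < 0)
    (hTα : a α + c α < 0) (hTβ : a β + c β < 0) :
    ∃ x₀ ∈ Ioo α β,
      (∀ μ : ℝ, ((a' x₀ - μ * a x₀) * (c' x₀ - μ * c x₀) - (b' x₀ - μ * b x₀) ^ 2) * (a x₀ + c x₀) ^ 2
          ≤ (a x₀ * c x₀ - b x₀ ^ 2) * ((a' x₀ + c' x₀) - μ * (a x₀ + c x₀)) ^ 2) ∧
      (∀ μ : ℝ, (a' x₀ - μ * a x₀) * (c' x₀ - μ * c x₀) - (b' x₀ - μ * b x₀) ^ 2 ≤ 0) ∧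
      (a' x₀ * c x₀ + a x₀ * c' x₀ - 2 * b x₀ * b' x₀) ^ 2
          ≤ 4 * (a x₀ * c x₀ - b x₀ ^ 2) * (a' x₀ * c' x₀ - b' x₀ ^ 2) ∧
      a' x₀ * c' x₀ - b' x₀ ^ 2 ≤ 0 := by
  obtain ⟨x₀, hx₀, h1, h2, h3, h4⟩ := exteriorTangent_gap_rows (a := fun x => -a x) (b := fun x => -b x) (c := fun x => -c x)
    (a' := fun x => -a' x) (b' := fun x => -b' x) (c' := fun x => -c' x)
    (fun x => (ha x).neg) (fun x => (hb x).neg) (fun x => (hc x).neg) hαβ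
    (by simpa [neg_mul_neg, neg_sq] using hfα) (by simpa [neg_mul_neg, neg_sq] using hfβ)
    (fun x hx => by simpa [neg_mul_neg, neg_sq] using hneg x hx) (by linarith) (by linarith)
  refine ⟨x₀, hx₀, fun μ => ?_, fun μ => ?_, ?_, ?_⟩
  · have := h1 μ; nlinarith [this]
  · have := h2 μ; nlinarith [this]
  · nlinarith [h3]
  · nlinarith [h4]

end Summit.ValiantsHypothesis.ValiantsHypothesis.Theorems.LacunarySymmetroidMatrixDescartes.Census
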